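import Literature.Analysis.ValidatedNumerics.ExpPoly.Poly
import HarnessLib

/-!
# `ExpPoly`: rescaling the argument of a coefficient list

`Poly.scaleArg p b` is the coefficient list of `x ↦ p(x/b)` (`k`-th coefficient `p_k / b^k`), with
`Poly.eval_scaleArg : eval (scaleArg p b) x = eval p (x / b)`.  Used to identify window profiles given as polynomials in
`x` (coefficients `P_k/b^k`) with profiles given in the scaled variable `y = x/b` (coefficients `P_k`).  [folklore]
-/

noncomputable section

namespace Literature.Analysis.ValidatedNumerics.ExpPoly

/-- Coefficient list of `x ↦ p(x/b)`: `(scaleArg p b)_k = p_k / b^k`. [folklore] -/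
def Poly.scaleArg : Poly → ℚ → Poly
  | [], _ => []
  | a :: p, b => a :: Poly.scaleArg (Poly.smul (1 / b) p) b
termination_by p => p.length
decreasing_by simp [Poly.smul]

/-- `eval (scaleArg p b) x = eval p (x/b)`. [folklore] -/
theorem Poly.eval_scaleArg : ∀ (p : Poly) (b : ℚ) (x : ℝ), Poly.eval (Poly.scaleArg p b) x = Poly.eval p (x / b)
  | [], b, x => by simp [Poly.scaleArg]
  | a :: p, b, x => by
      rw [Poly.scaleArg, Poly.eval_cons, Poly.eval_cons, Poly.eval_scaleArg (Poly.smul (1 / b) p) b x, Poly.eval_smul]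
      push_cast
      ring
termination_by p => p.length
decreasing_by simp [Poly.smul]

end Literature.Analysis.ValidatedNumerics.ExpPoly
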